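import Summits.QuantumFields.BalabanUV.Beta.FP.KernelPeriodisationFibLoc

/-!
# `BalabanUV.Beta.FP.TowerDoorPeriodisedLinear` — binder row D1, the row's ONE file, (T2) `hWΔT` part (D-a) (J-NOTE-21 §5; v10 `FP/StepRecursionFeedNestedNamedI` l.217):
# **THE SOURCE-WOUND TORUS TABLE `perF T ∘ dper T` IS LINEAR ACROSS A DOMINATED `tsum` FAMILY, INVARIANT UNDER A DIAGONAL PERIOD SHIFT OF THE KERNEL, AND ENTRYWISE THE FULL
# TWO-SIDED PERIOD SUM** — the three generic bookkeeping tools the (T2) periodisation identity consumes (kernel-generic `d`, `F`; no table, no record object)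
# (β-function cell `pub-balaban`, BINDER-OWNERS row D1 ∕ (C1) OWNER «beta-an2» gen 78, PART 70; imports `KernelPeriodisationFibLoc` ONLY)

WHY (located; J-NOTE-21 §5, journal [AN2-G78-ONLINE] A-1).  (T2)'s left side is `(perF T (dper T (x w ↦ Σ'_e 𝒲Δ (n+1) μ y ν (y′ + Mc•e) x w)))|ff`; entrywise
`perF T (dper T V) (x̄,a) (w̄,b) = Σ'_t Σ'_j V (x̄ + T∘j) (w̄ + T∘t + T∘j) a b` (`dper` = the diagonal copies, `perZ` = the one-sided winding of the second site).  After the source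
winding `Σ'_e` is evaluated POINTWISE (part (D-b)), the door kernel is a window superposition `κΔ·Σ_κ Σ'_{y₀} (…)` of bi-localised kernels with summable constants; the identity
then needs exactly: (i) `perZ T ∘ dper T` passes through such a superposition (`perZ_dper_tsum`, dominated Fubini over `ι × (ℤ^{d+1} × ℤ^{d+1})`), through finite sums and
scalars; (ii) `dper T` does not see a diagonal `T`-shift of the kernel (`dper_of_translate`: the window `y₀ ↦ y₀ + Mc•m₁` becomes a SOURCE shift); (iii) the dominating
family of ONE bi-localised kernel and of a bi-localised FAMILY with summable constants is summable (`summable_perZ_dper_of_biLoc`, `summable_perZ_dper_family_of_biLoc`).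

WHAT ([folklore] `tsum` bookkeeping BY NAME over road `KernelPeriodisationFib`∕`…FibLoc` (`perZ perF dper`, `summable_exp_l1_translate`) and Mathlib's
`Summable.tsum_prod ∕ tsum_comm ∕ prod_factor ∕ prod ∕ prod_symm`, `summable_prod_of_nonneg`, `Summable.of_norm_bounded`; no `def`, no `def … : Prop`, nothing cited, 0 sorry).
* §1 `perZ_dper_apply`, `perF_dper_apply` — the entry as the double translate sum.
* §2 `dper_of_translate`, `dper_shiftK_period`, `perZ_dper_of_translate`, `perF_dper_of_translate` — invariance under `V ↦ V(· + T∘m, · + T∘m)`.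
* §3 `summable_translate₂_majorant` (`Σ'_{(t,j)} e^{−δ(|x+T∘j−p|₁ + |y+T∘t+T∘j−q|₁)} ≤ K_{d+1}(δ)²`), `summable_perZ_dper_of_biLoc`, `summable_perZ_dper_family_of_biLoc`.
* §4 `perZ_dper_tsum` (the linearity across a dominated `tsum` family), `perZ_dper_tsum_of_biLoc`, `perZ_dper_add`, `perZ_dper_sub`, `perZ_dper_const_mul`, `perZ_dper_finset_sum`.
WHAT THIS IS NOT: not (T2) (parts (D-b) window regrouping, (D-c) the record); nothing of Bałaban's asserted, valued or discharged; 0 estimates beyond bookkeeping constants;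
0∕4 row-D1 binders (hW, hR, D1Tel, D1Rep); v10 NOT filed; v9 p617999 stands; NOT (C1), NOT (T-ID), NOT D1, NEVER «G-an2-4 closed», NOT BetaPertH, NOT continuum, NOT Clay.

HONEST DEPENDENCY (page 1, mandatory): continuum YM on T⁴ ⇐ BetaPertH ∧ nine spine estimates (0/9 proved); BetaPertH ⇐ (D1) ∧ (D4) ∧ CAP+tail;
G-an2-4 gates asym, D1 and NE2/3/4.  HONEST FRAMING (cell contract, verbatim): «discharging `BetaPertH` makes Bałaban's UV stability UNCONDITIONAL —
a real constructive-QFT result; it is NOT the continuum limit and NOT the Clay problem.»  ABSOLUTE RULE (cell charter, verbatim): «No internally-minted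
statement may enter as a cited fact. Every hypothesis is either kernel-proved in this package or a verbatim quotation of a PUBLISHED theorem with page
reference. The manuscript(s) under audit are NOT citable for their own disputed steps — they are the thing under adjudication; programme-internal
(2001/route/tribunal) claims are never citable.»  Row D1 ∕ (C1) OWNER «beta-an2» gen 78, 2026-08-29.  No existing file touched.
-/

noncomputable section

open scoped BigOperators
open Finset

namespace Summit.QuantumFields.BalabanUV.Beta.FP.TowerDoorPeriodisedLinear

open Literature.MathematicalPhysics.QuantumFieldTheory.Balaban1983to89
open Literature.MathematicalPhysics.QuantumFieldTheory.Balaban1983to89.Beta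
open B12Sec2to5 (l1 l1_nonneg)
open B4TorusKernel.MultiPeriod (translate translate_apply translate_injective)
open B4Reflection242 (translate_translate)
open B4Sect5Proof (latticeConst latticeConst_nonneg)
open B6Lemma24Torus (pbox)
open ExpKernelCalculus (MKer Decays BiLoc shiftK)
open Summit.QuantumFields.BalabanUV.Beta.FP.KernelPeriodisationFib (perZ perF Idx perZ_apply perF_apply translate_eq_add)
open Summit.QuantumFields.BalabanUV.Beta.FP.KernelPeriodisationFibLoc (dper dper_apply dper_translate summable_exp_l1_translate shiftK_eq_translate)

variable {d : ℕ} {F : Type*}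

/-! ## §1 The entry of `perZ T (dper T V)` as the double translate sum -/

section Unfold

variable (M : Fin (d + 1) → ℕ)

/-- [folklore] **`perZ M (dper M V)` ENTRYWISE**: `Σ'_t Σ'_j V (x + M∘j) (y + M∘t + M∘j) a b` — the diagonal copies (`dper`, inner `j`) wound once more in the second site (`perZ`, outer `t`). -/
theorem perZ_dper_apply (V : MKer (d + 1) F) (x y : Fin (d + 1) → ℤ) (a b : F) :
    perZ M (dper M V) x y a b
      = ∑' t : Fin (d + 1) → ℤ, ∑' j : Fin (d + 1) → ℤ, V (translate M x j) (translate M (translate M y t) j) a b := by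
  simp only [perZ_apply, dper_apply]

/-- [folklore] the same for the box matrix `perF M (dper M V)`. -/
theorem perF_dper_apply (V : MKer (d + 1) F) (p q : Idx M F) :
    perF M (dper M V) p q
      = ∑' t : Fin (d + 1) → ℤ, ∑' j : Fin (d + 1) → ℤ,
          V (translate M (p.1 : Fin (d + 1) → ℤ) j) (translate M (translate M (q.1 : Fin (d + 1) → ℤ) t) j) p.2 q.2 := by
  rw [perF_apply, perZ_dper_apply]

end Unfold

/-! ## §2 `dper` does not see a diagonal period shift of the kernel -/

section Shift

variable (M : Fin (d + 1) → ℕ)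

/-- [folklore] **`dper_of_translate`**: the diagonal periodisation of the kernel translated diagonally by a period vector `M∘m` is the diagonal periodisation of the kernel
(re-indexing `j ↦ j + m`; no convergence needed). -/
theorem dper_of_translate (V : MKer (d + 1) F) (m : Fin (d + 1) → ℤ) :
    dper M (fun x y a b => V (translate M x m) (translate M y m) a b) = dper M V := by
  funext x y a b
  simp only [dper_apply, translate_translate]
  exact (Equiv.addRight m).tsum_eq (fun j : Fin (d + 1) → ℤ => V (translate M x j) (translate M y j) a b)

/-- [folklore] the same with the shift written as `shiftK (M∘m)`. -/
theorem dper_shiftK_period (V : MKer (d + 1) F) (m : Fin (d + 1) → ℤ) :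
    dper M (shiftK (fun i => (M i : ℤ) * m i) V) = dper M V := by
  have h : shiftK (fun i => (M i : ℤ) * m i) V = fun x y a b => V (translate M x m) (translate M y m) a b := by
    funext x y a b; exact shiftK_eq_translate M V m x y a b
  rw [h, dper_of_translate]

/-- [folklore] hence `perZ M (dper M ·)` does not see the shift either … -/
theorem perZ_dper_of_translate (V : MKer (d + 1) F) (m : Fin (d + 1) → ℤ) :
    perZ M (dper M (fun x y a b => V (translate M x m) (translate M y m) a b)) = perZ M (dper M V) := by
  rw [dper_of_translate]

/-- [folklore] … nor does the box matrix `perF M (dper M ·)`. -/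
theorem perF_dper_of_translate (V : MKer (d + 1) F) (m : Fin (d + 1) → ℤ) :
    perF M (dper M (fun x y a b => V (translate M x m) (translate M y m) a b)) = perF M (dper M V) := by
  rw [dper_of_translate]

end Shift

/-! ## §3 The dominating families: one bi-localised kernel, a bi-localised family with summable constants -/

section Dominated

variable (M : Fin (d + 1) → ℕ) [∀ μ, NeZero (M μ)]

/-- [folklore] **the two-sided translate majorant is summable**: `Σ'_{(t,j)} e^{−δ(|x+M∘j−p|₁ + |y+M∘t+M∘j−q|₁)}` converges and is `≤ K_{d+1}(δ)²` (the `t`-sum at fixed `j` is a translate sum based at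
`y + M∘j`, then the `j`-sum; `summable_prod_of_nonneg` in the order `(j, t)`, transported by `Equiv.prodComm`). -/
theorem summable_translate₂_majorant {δ : ℝ} (hδ : 0 < δ) (p q x y : Fin (d + 1) → ℤ) :
    Summable (fun c : (Fin (d + 1) → ℤ) × (Fin (d + 1) → ℤ) =>
        Real.exp (-δ * (l1 (translate M x c.2 - p) + l1 (translate M (translate M y c.1) c.2 - q)))) ∧
      ∑' c : (Fin (d + 1) → ℤ) × (Fin (d + 1) → ℤ),
          Real.exp (-δ * (l1 (translate M x c.2 - p) + l1 (translate M (translate M y c.1) c.2 - q)))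
        ≤ latticeConst (d + 1) δ * latticeConst (d + 1) δ := by
  have hK0 : 0 ≤ latticeConst (d + 1) δ := latticeConst_nonneg (d + 1) hδ.le
  -- the family in the order `(j, t)`: inner `t`-sums are translate sums based at `y + M∘j`
  have hin : ∀ j : Fin (d + 1) → ℤ,
      Summable (fun t : Fin (d + 1) → ℤ =>
        Real.exp (-δ * l1 (translate M x j - p)) * Real.exp (-δ * l1 (translate M (translate M y j) t - q))) ∧
      ∑' t : Fin (d + 1) → ℤ, Real.exp (-δ * l1 (translate M x j - p)) * Real.exp (-δ * l1 (translate M (translate M y j) t - q))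
        ≤ Real.exp (-δ * l1 (translate M x j - p)) * latticeConst (d + 1) δ := by
    intro j
    obtain ⟨hs, hle⟩ := summable_exp_l1_translate M hδ q (translate M y j)
    refine ⟨hs.mul_left (Real.exp (-δ * l1 (translate M x j - p))), ?_⟩
    rw [tsum_mul_left]
    exact mul_le_mul_of_nonneg_left hle (Real.exp_pos _).le
  obtain ⟨hsj, hlej⟩ := summable_exp_l1_translate M hδ p x
  have hnn : ∀ c : (Fin (d + 1) → ℤ) × (Fin (d + 1) → ℤ),
      0 ≤ Real.exp (-δ * l1 (translate M x c.1 - p)) * Real.exp (-δ * l1 (translate M (translate M y c.1) c.2 - q)) :=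
    fun c => mul_nonneg (Real.exp_pos _).le (Real.exp_pos _).le
  have hout : Summable (fun j : Fin (d + 1) → ℤ =>
      ∑' t : Fin (d + 1) → ℤ, Real.exp (-δ * l1 (translate M x j - p)) * Real.exp (-δ * l1 (translate M (translate M y j) t - q))) :=
    (hsj.mul_right (latticeConst (d + 1) δ)).of_nonneg_of_le (fun j => tsum_nonneg fun t => hnn (j, t)) (fun j => (hin j).2)
  have hgs : Summable (fun c : (Fin (d + 1) → ℤ) × (Fin (d + 1) → ℤ) =>
      Real.exp (-δ * l1 (translate M x c.1 - p)) * Real.exp (-δ * l1 (translate M (translate M y c.1) c.2 - q))) :=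
    (summable_prod_of_nonneg hnn).2 ⟨fun j => (hin j).1, hout⟩
  have hgle : ∑' c : (Fin (d + 1) → ℤ) × (Fin (d + 1) → ℤ),
      Real.exp (-δ * l1 (translate M x c.1 - p)) * Real.exp (-δ * l1 (translate M (translate M y c.1) c.2 - q))
        ≤ latticeConst (d + 1) δ * latticeConst (d + 1) δ := by
    rw [hgs.tsum_prod]
    calc ∑' j : Fin (d + 1) → ℤ, ∑' t : Fin (d + 1) → ℤ,
          Real.exp (-δ * l1 (translate M x j - p)) * Real.exp (-δ * l1 (translate M (translate M y j) t - q))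
        ≤ ∑' j : Fin (d + 1) → ℤ, Real.exp (-δ * l1 (translate M x j - p)) * latticeConst (d + 1) δ :=
          hout.tsum_le_tsum (fun j => (hin j).2) (hsj.mul_right _)
      _ = (∑' j : Fin (d + 1) → ℤ, Real.exp (-δ * l1 (translate M x j - p))) * latticeConst (d + 1) δ := tsum_mul_right
      _ ≤ latticeConst (d + 1) δ * latticeConst (d + 1) δ := mul_le_mul_of_nonneg_right hlej hK0
  -- transport to the order `(t, j)`
  have hident : (fun c : (Fin (d + 1) → ℤ) × (Fin (d + 1) → ℤ) =>
      Real.exp (-δ * (l1 (translate M x c.2 - p) + l1 (translate M (translate M y c.1) c.2 - q))))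
      = fun c => (fun c' : (Fin (d + 1) → ℤ) × (Fin (d + 1) → ℤ) =>
          Real.exp (-δ * l1 (translate M x c'.1 - p)) * Real.exp (-δ * l1 (translate M (translate M y c'.1) c'.2 - q)))
            ((Equiv.prodComm _ _) c) := by
    funext c
    simp only [Equiv.prodComm_apply, Prod.fst_swap, Prod.snd_swap]
    rw [← Real.exp_add, translate_translate, translate_translate, add_comm c.2 c.1]
    congr 1
    ring
  rw [hident]
  refine ⟨(Equiv.prodComm _ _).summable_iff.2 hgs, ?_⟩
  rw [(Equiv.prodComm _ _).tsum_eq (fun c' : (Fin (d + 1) → ℤ) × (Fin (d + 1) → ℤ) =>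
    Real.exp (-δ * l1 (translate M x c'.1 - p)) * Real.exp (-δ * l1 (translate M (translate M y c'.1) c'.2 - q)))]
  exact hgle

variable {V : MKer (d + 1) F} {p q : Fin (d + 1) → ℤ} {C δ : ℝ}

/-- [folklore] **`summable_perZ_dper_of_biLoc`**: the double translate family of ONE bi-localised kernel is summable (majorant `C·e^{−δ(…)}`, §3's translate² sum). -/
theorem summable_perZ_dper_of_biLoc (hV : BiLoc V p q C δ) (hδ : 0 < δ) (x y : Fin (d + 1) → ℤ) (a b : F) :
    Summable (fun c : (Fin (d + 1) → ℤ) × (Fin (d + 1) → ℤ) => V (translate M x c.2) (translate M (translate M y c.1) c.2) a b) :=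
  (((summable_translate₂_majorant M hδ p q x y).1).mul_left C).of_norm_bounded fun c => by
    rw [Real.norm_eq_abs]; exact hV _ _ a b

/-- [folklore] the entry bound that goes with it: `|perZ M (dper M V) x y a b| ≤ C·K_{d+1}(δ)²`. -/
theorem abs_perZ_dper_le_of_biLoc (hV : BiLoc V p q C δ) (hC : 0 ≤ C) (hδ : 0 < δ) (x y : Fin (d + 1) → ℤ) (a b : F) :
    |perZ M (dper M V) x y a b| ≤ C * (latticeConst (d + 1) δ * latticeConst (d + 1) δ) := by
  obtain ⟨hm, hle⟩ := summable_translate₂_majorant M hδ p q x y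
  have hs := summable_perZ_dper_of_biLoc M hV hδ x y a b
  rw [perZ_dper_apply, ← hs.tsum_prod]
  have hb := tsum_of_norm_bounded (hm.mul_left C).hasSum (fun c : (Fin (d + 1) → ℤ) × (Fin (d + 1) → ℤ) => by
    rw [Real.norm_eq_abs]; exact hV (translate M x c.2) (translate M (translate M y c.1) c.2) a b)
  rw [Real.norm_eq_abs] at hb
  refine hb.trans ?_
  rw [tsum_mul_left]
  exact mul_le_mul_of_nonneg_left hle hC

/-- [folklore] **`summable_perZ_dper_family_of_biLoc`**: for a FAMILY `V i` bi-localised at `(p i, q i)` at one rate `δ` with constants `C i ≥ 0`, `Σ_i C i < ∞`, the joint family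
`(i, (t, j)) ↦ V i (x + M∘j) (y + M∘t + M∘j) a b` is summable (majorant `C i · e^{−δ(…)}`; `summable_prod_of_nonneg` in the order `(i, (t,j))`). -/
theorem summable_perZ_dper_family_of_biLoc {ι : Type*} {W : ι → MKer (d + 1) F} {pf qf : ι → Fin (d + 1) → ℤ} {Cf : ι → ℝ}
    (hW : ∀ i, BiLoc (W i) (pf i) (qf i) (Cf i) δ) (hCf : ∀ i, 0 ≤ Cf i) (hδ : 0 < δ) (hCs : Summable Cf)
    (x y : Fin (d + 1) → ℤ) (a b : F) :
    Summable (fun s : ι × ((Fin (d + 1) → ℤ) × (Fin (d + 1) → ℤ)) =>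
      W s.1 (translate M x s.2.2) (translate M (translate M y s.2.1) s.2.2) a b) := by
  set G : ι × ((Fin (d + 1) → ℤ) × (Fin (d + 1) → ℤ)) → ℝ := fun s =>
    Cf s.1 * Real.exp (-δ * (l1 (translate M x s.2.2 - pf s.1) + l1 (translate M (translate M y s.2.1) s.2.2 - qf s.1))) with hG
  have hG0 : 0 ≤ G := fun s => by rw [hG]; exact mul_nonneg (hCf s.1) (Real.exp_pos _).le
  have hK0 : 0 ≤ latticeConst (d + 1) δ := latticeConst_nonneg (d + 1) hδ.le
  have hin : ∀ i : ι, Summable (fun c : (Fin (d + 1) → ℤ) × (Fin (d + 1) → ℤ) => G (i, c)) ∧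
      ∑' c, G (i, c) ≤ Cf i * (latticeConst (d + 1) δ * latticeConst (d + 1) δ) := by
    intro i
    obtain ⟨hm, hle⟩ := summable_translate₂_majorant M hδ (pf i) (qf i) x y
    refine ⟨hm.mul_left (Cf i), ?_⟩
    simp only [hG]
    rw [tsum_mul_left]
    exact mul_le_mul_of_nonneg_left hle (hCf i)
  have hout : Summable (fun i : ι => ∑' c, G (i, c)) :=
    (hCs.mul_right (latticeConst (d + 1) δ * latticeConst (d + 1) δ)).of_nonneg_of_le
      (fun i => tsum_nonneg fun c => hG0 (i, c)) (fun i => (hin i).2)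
  have hGs : Summable G := (summable_prod_of_nonneg hG0).2 ⟨fun i => (hin i).1, hout⟩
  refine hGs.of_norm_bounded fun s => ?_
  rw [Real.norm_eq_abs, hG]
  exact hW s.1 _ _ a b

end Dominated

/-! ## §4 `perZ T (dper T ·)` is linear across a dominated `tsum` family, finite sums and scalars -/

section Linear

variable (M : Fin (d + 1) → ℕ)

/-- [folklore] **`perZ_dper_tsum` — THE SOURCE-WOUND TORUS TABLE OF A DOMINATED SUPERPOSITION IS THE SUPERPOSITION OF THE TABLES**: if the joint family
`(i, (t, j)) ↦ V i (x + M∘j) (y + M∘t + M∘j) a b` is summable, then `perZ M (dper M (x y a b ↦ Σ'_i V i x y a b)) x y a b = Σ'_i perZ M (dper M (V i)) x y a b`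
(Mathlib `Summable.tsum_prod`, `Summable.tsum_comm`, `Summable.prod_factor`, `Summable.prod`, `Summable.prod_symm` on `ℝ`). -/
theorem perZ_dper_tsum {ι : Type*} (W : ι → MKer (d + 1) F) (x y : Fin (d + 1) → ℤ) (a b : F)
    (hs : Summable (fun s : ι × ((Fin (d + 1) → ℤ) × (Fin (d + 1) → ℤ)) =>
      W s.1 (translate M x s.2.2) (translate M (translate M y s.2.1) s.2.2) a b)) :
    perZ M (dper M (fun x' y' a' b' => ∑' i : ι, W i x' y' a' b')) x y a b = ∑' i : ι, perZ M (dper M (W i)) x y a b := by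
  simp only [perZ_dper_apply]
  have hs' : Summable (Function.uncurry (fun (i : ι) (c : (Fin (d + 1) → ℤ) × (Fin (d + 1) → ℤ)) =>
      W i (translate M x c.2) (translate M (translate M y c.1) c.2) a b)) := hs
  have hsw : Summable (fun q : ((Fin (d + 1) → ℤ) × (Fin (d + 1) → ℤ)) × ι =>
      W q.2 (translate M x q.1.2) (translate M (translate M y q.1.1) q.1.2) a b) := hs.prod_symm
  calc (∑' t : Fin (d + 1) → ℤ, ∑' j : Fin (d + 1) → ℤ, ∑' i : ι, W i (translate M x j) (translate M (translate M y t) j) a b)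
      = ∑' c : (Fin (d + 1) → ℤ) × (Fin (d + 1) → ℤ), ∑' i : ι, W i (translate M x c.2) (translate M (translate M y c.1) c.2) a b :=
        (hsw.prod.tsum_prod).symm
    _ = ∑' i : ι, ∑' c : (Fin (d + 1) → ℤ) × (Fin (d + 1) → ℤ), W i (translate M x c.2) (translate M (translate M y c.1) c.2) a b :=
        hs'.tsum_comm
    _ = ∑' i : ι, ∑' t : Fin (d + 1) → ℤ, ∑' j : Fin (d + 1) → ℤ, W i (translate M x j) (translate M (translate M y t) j) a b :=
        tsum_congr fun i => (hs'.prod_factor i).tsum_prod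

variable [∀ μ, NeZero (M μ)] in
/-- [folklore] **`perZ_dper_tsum_of_biLoc`**: the same for a family bi-localised at `(p i, q i)` at one rate with summable constants (§3's dominating family). -/
theorem perZ_dper_tsum_of_biLoc {ι : Type*} {W : ι → MKer (d + 1) F} {pf qf : ι → Fin (d + 1) → ℤ} {Cf : ι → ℝ} {δ : ℝ}
    (hW : ∀ i, BiLoc (W i) (pf i) (qf i) (Cf i) δ) (hCf : ∀ i, 0 ≤ Cf i) (hδ : 0 < δ) (hCs : Summable Cf)
    (x y : Fin (d + 1) → ℤ) (a b : F) :
    perZ M (dper M (fun x' y' a' b' => ∑' i : ι, W i x' y' a' b')) x y a b = ∑' i : ι, perZ M (dper M (W i)) x y a b :=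
  perZ_dper_tsum M W x y a b (summable_perZ_dper_family_of_biLoc M hW hCf hδ hCs x y a b)

/-- [folklore] **`perZ_dper_add`**: additivity, under the summability of the two double translate families. -/
theorem perZ_dper_add {V W : MKer (d + 1) F} (x y : Fin (d + 1) → ℤ) (a b : F)
    (hV : Summable (fun c : (Fin (d + 1) → ℤ) × (Fin (d + 1) → ℤ) => V (translate M x c.2) (translate M (translate M y c.1) c.2) a b))
    (hW : Summable (fun c : (Fin (d + 1) → ℤ) × (Fin (d + 1) → ℤ) => W (translate M x c.2) (translate M (translate M y c.1) c.2) a b)) :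
    perZ M (dper M (fun x' y' a' b' => V x' y' a' b' + W x' y' a' b')) x y a b = perZ M (dper M V) x y a b + perZ M (dper M W) x y a b := by
  simp only [perZ_dper_apply]
  calc (∑' t : Fin (d + 1) → ℤ, ∑' j : Fin (d + 1) → ℤ,
        (V (translate M x j) (translate M (translate M y t) j) a b + W (translate M x j) (translate M (translate M y t) j) a b))
      = ∑' t : Fin (d + 1) → ℤ, ((∑' j : Fin (d + 1) → ℤ, V (translate M x j) (translate M (translate M y t) j) a b)
          + ∑' j : Fin (d + 1) → ℤ, W (translate M x j) (translate M (translate M y t) j) a b) :=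
        tsum_congr fun t => (hV.prod_factor t).tsum_add (hW.prod_factor t)
    _ = _ := hV.prod.tsum_add hW.prod

/-- [folklore] **`perZ_dper_sub`**: the same for a difference. -/
theorem perZ_dper_sub {V W : MKer (d + 1) F} (x y : Fin (d + 1) → ℤ) (a b : F)
    (hV : Summable (fun c : (Fin (d + 1) → ℤ) × (Fin (d + 1) → ℤ) => V (translate M x c.2) (translate M (translate M y c.1) c.2) a b))
    (hW : Summable (fun c : (Fin (d + 1) → ℤ) × (Fin (d + 1) → ℤ) => W (translate M x c.2) (translate M (translate M y c.1) c.2) a b)) :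
    perZ M (dper M (fun x' y' a' b' => V x' y' a' b' - W x' y' a' b')) x y a b = perZ M (dper M V) x y a b - perZ M (dper M W) x y a b := by
  simp only [perZ_dper_apply]
  calc (∑' t : Fin (d + 1) → ℤ, ∑' j : Fin (d + 1) → ℤ,
        (V (translate M x j) (translate M (translate M y t) j) a b - W (translate M x j) (translate M (translate M y t) j) a b))
      = ∑' t : Fin (d + 1) → ℤ, ((∑' j : Fin (d + 1) → ℤ, V (translate M x j) (translate M (translate M y t) j) a b)
          - ∑' j : Fin (d + 1) → ℤ, W (translate M x j) (translate M (translate M y t) j) a b) :=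
        tsum_congr fun t => (hV.prod_factor t).tsum_sub (hW.prod_factor t)
    _ = _ := hV.prod.tsum_sub hW.prod

/-- [folklore] **`perZ_dper_const_mul`**: a scalar passes through (no convergence needed). -/
theorem perZ_dper_const_mul (c : ℝ) (V : MKer (d + 1) F) (x y : Fin (d + 1) → ℤ) (a b : F) :
    perZ M (dper M (fun x' y' a' b' => c * V x' y' a' b')) x y a b = c * perZ M (dper M V) x y a b := by
  simp only [perZ_dper_apply, tsum_mul_left]

/-- [folklore] **`perZ_dper_finset_sum`**: a finite sum passes through, under the summability of each double translate family (Mathlib `Summable.tsum_finsetSum` twice). -/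
theorem perZ_dper_finset_sum {κs : Type*} (s : Finset κs) (W : κs → MKer (d + 1) F) (x y : Fin (d + 1) → ℤ) (a b : F)
    (hW : ∀ k ∈ s, Summable (fun c : (Fin (d + 1) → ℤ) × (Fin (d + 1) → ℤ) =>
      W k (translate M x c.2) (translate M (translate M y c.1) c.2) a b)) :
    perZ M (dper M (fun x' y' a' b' => ∑ k ∈ s, W k x' y' a' b')) x y a b = ∑ k ∈ s, perZ M (dper M (W k)) x y a b := by
  simp only [perZ_dper_apply]
  calc (∑' t : Fin (d + 1) → ℤ, ∑' j : Fin (d + 1) → ℤ, ∑ k ∈ s, W k (translate M x j) (translate M (translate M y t) j) a b)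
      = ∑' t : Fin (d + 1) → ℤ, ∑ k ∈ s, ∑' j : Fin (d + 1) → ℤ, W k (translate M x j) (translate M (translate M y t) j) a b :=
        tsum_congr fun t => Summable.tsum_finsetSum (fun k hk => (hW k hk).prod_factor t)
    _ = ∑ k ∈ s, ∑' t : Fin (d + 1) → ℤ, ∑' j : Fin (d + 1) → ℤ, W k (translate M x j) (translate M (translate M y t) j) a b :=
        Summable.tsum_finsetSum (fun k hk => (hW k hk).prod)

end Linear

end Summit.QuantumFields.BalabanUV.Beta.FP.TowerDoorPeriodisedLinear

end
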